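import Literature.NumberTheory.GaloisCohomology.ShaRestrictedShapiroLayer
import Literature.NumberTheory.GaloisRepresentations.ContinuousShapiroOpenCoinducedLayerChange
import HarnessLib

/-!
# The Ш-condition transport under CHANGE OF LAYER `N′ ≤ N` and of coefficients: the corestriction / restriction /
# coefficient dictionary of the layer Poitou–Tate pairing (Milne I §4; NSW (1.5.3)–(1.6.5); Serre I §2.5)

Topic `NumberTheory/GaloisCohomology`; namespace `Literature.NumberTheory.GaloisCohomology.ShaLayer`.  THEOREMS ONLY
(no definition, no named fact, no `sorry`, no instance, no notation).  File 6 of the (M7) «Ш-condition transport under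
restricted Shapiro» series of cell `bsd-print-cf2`; sequel of `ShaRestrictedShapiroLayer` (the transport
`T_N = restrictedCohomologyEquiv S ρ N hN hNS hρ n : Hⁿ(G_S, (Ind_N^{Γ_K} M)^{N_S}) ≃+ Hⁿ(G_S, Maps(G_S ⧸ N̄, M^{N_S}))`, the
restricted Shapiro isomorphism `sh_S^N = layerShapiroEquiv S ρ N hN n` onto `Hⁿ(N̄, M^{N_S})`, `N̄ = N.map π ≤ G_S`), of its (N-conj)
companion `ShaRestrictedShapiroLayerConj` (right translations ↦ `layerConj`), and of the generic dictionary
`GaloisRepresentations/ContinuousShapiroOpenCoinducedLayerChange` (`sh ∘ Hⁿ(coindFinSum) = relCor ∘ sh`,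
`sh ∘ Hⁿ(coindFinRes) = resLe ∘ sh`, `sh ∘ Hⁿ(coindFinMap f) = Hⁿ(f|) ∘ sh`, every degree).

Setting: `K` a number field, `S` a set of finite places, `N_S ≤ Γ_K`, `G_S = Γ_K ⧸ N_S`, `π = toUnramifiedQuot K S`;
`ρ : DiscreteGaloisModule K M` unramified outside `S` (`hρ : N_S ≤ ker ρ`); `N′ ≤ N` open normal subgroups of `Γ_K` containing
`N_S` (`N = Gal(K̄/L)`, `N′ = Gal(K̄/L′)`, `K ⊆ L ⊆ L′ ⊂ K_S`).  The three morphisms of discrete `Γ_K`-modules between the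
permutation models `ρ.coindOpen N hN = Maps(Γ_K ⧸ N, M) = Ind_N^{Γ_K} M` (tree, `ContinuousShapiroLiftPairing` /
`ContinuousShapiroLiftFunctor`):

* the FIBRE SUM (trace) `Σ = coindFinSum ρ.toTopRep h : Maps(Γ_K ⧸ N′, M) ⟶ Maps(Γ_K ⧸ N, M)`, `(Σψ)(gN) = Σ_{g′N′ ⊆ gN} ψ(g′N′)`;
* the PULL-BACK `π^* = coindFinRes ρ.toTopRep h : Maps(Γ_K ⧸ N, M) ⟶ Maps(Γ_K ⧸ N′, M)`, `φ ↦ φ ∘ (Γ_K ⧸ N′ → Γ_K ⧸ N)`;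
* the COEFFICIENT CHANGE `coindFinMap F N : Maps(Γ_K ⧸ N, M) ⟶ Maps(Γ_K ⧸ N, M′)` along `F : M → M′`;

act on `restrictedCohomology (ρ.coindOpen · ·) S n = Hⁿ(G_S, (Ind M)^{N_S})` through Mathlib's
`ContinuousCohomology.map (id G_S) (ContinuousRep.invariantsHom ·) n` (the currency of the naturality clause (N) of the
tree's `poitouTate_shaRestricted_tateDual_natural_at` and of `RestrictedCohomologyFunctoriality`).  This file proves, in
EVERY degree `n`:

* §1 module level: `mapsEquiv` / `invariantsEquiv` intertwine `Σ`, `π^*`, `Maps(F)` on `Maps(Γ_K ⧸ ·, M)^{N_S}` with the SAME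
  operations on the `G_S`-permutation modules `Maps(G_S ⧸ N̄·, M^{N_S})` (`mapsEquiv_coindFinSum/_coindFinRes/_coindFinMap`);
* §2 `T ∘ Hⁿ(G_S, Σ) = Hⁿ(G_S, Σ̄) ∘ T` etc. (`restrictedCohomologyEquiv_map_coindFinSum/_coindFinRes/_coindFinMap`);
* §3 THE DICTIONARY:
  **(S-cor)** `sh_S^N (T_N (Hⁿ(G_S, Σ) c)) = relCor N̄ N̄′ (sh_S^{N′} (T_{N′} c))` (`layerShapiroEquiv_transport_coindFinSum`) — the
  trace `Ind_{N′} → Ind_N` becomes the relative CORESTRICTION `cor_{L′/L} : Hⁿ(N̄′, M^{N_S}) → Hⁿ(N̄, M^{N_S})` of the layer groups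
  (the tree's `relCor = cor ∘ toSubgroupOf`, = cell `bsd-print-cf2`'s `JohnsonLeungKings2011.relCores` on the nose);
  **(S-res)** `sh_S^{N′} (T_{N′} (Hⁿ(G_S, π^*) c)) = resLe (sh_S^N (T_N c))` (`layerShapiroEquiv_transport_coindFinRes`) — the
  pull-back becomes the RESTRICTION `res_{L′/L}`;
  **(S-coeff)** `sh_S'^N (T'_N (Hⁿ(G_S, Maps(F)) c)) = Hⁿ(N̄, F^{N_S}|) (sh_S^N (T_N c))` (`layerShapiroEquiv_transport_coindFinMap`).
  With (S-conj) of `ShaRestrictedShapiroLayerConj` this is the complete layer-change dictionary of the transport; on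
  `Шⁿ_S` itself (`shaRestrictedLayerEquiv_one/_two`) the identities are read through `coe_shaRestrictedLayerEquiv_one/_two`
  (`rfl`) and `DiscreteGaloisModule.map_mem_shaRestricted`.

Consumer: ROW 1 of the JLK descent (cell `bsd-print-cf2`, deciding child `MainConjClauseAtSplitTwoQuadDA` of crux
stmt-BirchSwinnertonDyer-24721): the layer Poitou–Tate pairings along the `ℤ_p²`-tower `K̃_n` are compatible with
`cor` (first variable) / `res` (second variable) / `ζ ↦ ζ^p` (coefficients) because Poitou–Tate for `Ind M` is NATURAL in
the module and `Σ ⊣ π^*` under the local pairings (the adjointness is the consumer's half).  HONEST FRAMING: bookkeeping of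
continuous cohomology; no arithmetic duality and no case of BSD is proved here.

## References
* J. S. Milne, *Arithmetic Duality Theorems*, 2nd ed. (2006), Ch. I §4 (pp. 55–57; canonicity of the pairings p. 65).
  [MilneADT2006]
* J. Neukirch, A. Schmidt, K. Wingberg, *Cohomology of Number Fields*, 2nd ed. (2008), I §5 Prop. (1.5.3)–(1.5.4), I §6
  Prop. (1.6.4)–(1.6.5). [NeukirchSchmidtWingberg2008]
* J.-P. Serre, *Galois Cohomology* (1997), I §2.5 (induced modules, `cor = H(π) ∘ sh⁻¹`). [SerreGaloisCohomology1997]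
* J.-P. Serre, *Local Fields* (1979), VII §5–§6. [SerreLocalFields1979]
* D. Harari, *Galois Cohomology and Class Field Theory* (2020), §17.2–17.3. [Harari2020]
-/

noncomputable section

open CategoryTheory Function NumberField Field IsDedekindDomain
open scoped NumberField Classical

namespace Literature.NumberTheory.GaloisCohomology

open Literature.NumberTheory.GaloisRepresentations
open Literature.NumberTheory.GaloisRepresentations.DiscreteGaloisModule (restrictedCohomology
  restrictedLocalization shaRestricted quotientInvariants)
open _root_.TopRep

namespace ShaLayer

variable {K : Type} [Field K] [NumberField K] (S : Set (HeightOneSpectrum (𝓞 K)))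
variable {M : Type} [AddCommGroup M] [TopologicalSpace M] [DiscreteTopology M] (ρ : DiscreteGaloisModule K M)
variable {M' : Type} [AddCommGroup M'] [TopologicalSpace M'] [DiscreteTopology M'] (ρ' : DiscreteGaloisModule K M')
variable (N N' : Subgroup (absoluteGaloisGroup K)) [N.Normal] [N'.Normal]
  (hN : IsOpen (N : Set (absoluteGaloisGroup K))) (hN' : IsOpen (N' : Set (absoluteGaloisGroup K))) (h : N' ≤ N)
variable (hNS : ramificationSubgroup K S ≤ N) (hN'S : ramificationSubgroup K S ≤ N')
  (hρ : ramificationSubgroup K S ≤ ContinuousRep.ker ρ) (hρ' : ramificationSubgroup K S ≤ ContinuousRep.ker ρ')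

/-! ## §1 `mapsEquiv` intertwines the fibre sum, the pull-back and the coefficient change -/

section Module

/-- **`mapsEquiv (ψ ∘ π) = (mapsEquiv ψ) ∘ π̄`**: the transport `Maps(Γ_K ⧸ ·, M) ≅ Maps(G_S ⧸ ·̄, M^{N_S})` intertwines the
pull-backs along `Γ_K ⧸ N′ → Γ_K ⧸ N` and `G_S ⧸ N̄′ → G_S ⧸ N̄`. [cite: NeukirchSchmidtWingberg2008, I §5 Prop. (1.5.3)]
[cite: Harari2020, Def. 15.36] -/
theorem mapsEquiv_coindFinRes (φ : absoluteGaloisGroup K ⧸ N → M) :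
    mapsEquiv S ρ N' hN' hN'S hρ ((coindFinRes ρ.toTopRep h).hom φ) =
      (coindFinRes (ρ.quotientInvariants (ramificationSubgroup K S)).toTopRep (Subgroup.map_mono h)).hom
        (mapsEquiv S ρ N hN hNS hρ φ) := by
  funext yb
  obtain ⟨x, rfl⟩ := QuotientGroup.mk_surjective yb
  obtain ⟨g, rfl⟩ := QuotientGroup.mk_surjective x
  apply Subtype.ext
  rw [mapsEquiv_apply_mk_mk, coindFinRes_apply, coindFinRes_apply, Subgroup.quotientMapOfLE_apply_mk,
    Subgroup.quotientMapOfLE_apply_mk, mapsEquiv_apply_mk_mk]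

/-- **`mapsEquiv (F ∘ φ) = F^{N_S} ∘ mapsEquiv φ`**: the transport intertwines the coefficient changes along a morphism
`F : M → M′` of discrete `Γ_K`-modules (`F^{N_S} = ContinuousRep.invariantsHom F` on `M^{N_S}`).
[cite: NeukirchSchmidtWingberg2008, I §6 (induced modules)] [cite: Harari2020, Def. 15.36] -/
theorem mapsEquiv_coindFinMap (F : ρ.toTopRep ⟶ ρ'.toTopRep) (φ : absoluteGaloisGroup K ⧸ N → M) :
    mapsEquiv S ρ' N hN hNS hρ' ((coindFinMap F N).hom φ) =
      (coindFinMap (ContinuousRep.invariantsHom (N := ramificationSubgroup K S) F)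
        (N.map (toUnramifiedQuot K S))).hom (mapsEquiv S ρ N hN hNS hρ φ) := by
  funext yb
  obtain ⟨x, rfl⟩ := QuotientGroup.mk_surjective yb
  obtain ⟨g, rfl⟩ := QuotientGroup.mk_surjective x
  apply Subtype.ext
  rw [mapsEquiv_apply_mk_mk, coindFinMap_apply, coindFinMap_apply, ContinuousRep.invariantsHom_hom_apply_coe,
    mapsEquiv_apply_mk_mk]

/-- **`mapsEquiv (Σ ψ) = Σ̄ (mapsEquiv ψ)`**: the transport intertwines the fibre sums along `Γ_K ⧸ N′ → Γ_K ⧸ N` and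
`G_S ⧸ N̄′ → G_S ⧸ N̄` (reindexing along `G_S ⧸ N̄′ ≃ Γ_K ⧸ N′`, which commutes with the projections; the `Fintype`
instances are arbitrary). [cite: NeukirchSchmidtWingberg2008, I §5 Prop. (1.5.3)] [cite: Harari2020, Def. 15.36] -/
theorem mapsEquiv_coindFinSum [Fintype (absoluteGaloisGroup K ⧸ N')]
    [Fintype (GaloisGroupUnramifiedOutside K S ⧸ N'.map (toUnramifiedQuot K S))] (ψ : absoluteGaloisGroup K ⧸ N' → M) :
    mapsEquiv S ρ N hN hNS hρ ((coindFinSum ρ.toTopRep h).hom ψ) =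
      (coindFinSum (ρ.quotientInvariants (ramificationSubgroup K S)).toTopRep (Subgroup.map_mono h)).hom
        (mapsEquiv S ρ N' hN' hN'S hρ ψ) := by
  funext yb
  obtain ⟨x, rfl⟩ := QuotientGroup.mk_surjective yb
  obtain ⟨g, rfl⟩ := QuotientGroup.mk_surjective x
  apply Subtype.ext
  rw [mapsEquiv_apply_mk_mk, coindFinSum_apply, coindFinSum_apply, AddSubmonoidClass.coe_finsetSum]
  symm
  refine Fintype.sum_equiv (cosetEquiv S N' hN'S).toEquiv _ _ fun zb => ?_
  obtain ⟨x', rfl⟩ := QuotientGroup.mk_surjective zb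
  obtain ⟨g', rfl⟩ := QuotientGroup.mk_surjective x'
  rw [MulEquiv.toEquiv_eq_coe, MulEquiv.coe_toEquiv, cosetEquiv_mk_mk, Subgroup.quotientMapOfLE_apply_mk,
    Subgroup.quotientMapOfLE_apply_mk]
  by_cases hc : (QuotientGroup.mk g' : absoluteGaloisGroup K ⧸ N) = QuotientGroup.mk g
  · have hc' : (QuotientGroup.mk (QuotientGroup.mk g' : GaloisGroupUnramifiedOutside K S) :
        GaloisGroupUnramifiedOutside K S ⧸ N.map (toUnramifiedQuot K S)) =
          QuotientGroup.mk (QuotientGroup.mk g : GaloisGroupUnramifiedOutside K S) :=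
      (cosetEquiv S N hNS).injective (by rw [cosetEquiv_mk_mk, cosetEquiv_mk_mk]; exact hc)
    rw [if_pos hc', if_pos hc, mapsEquiv_apply_mk_mk]
  · have hc' : ¬ (QuotientGroup.mk (QuotientGroup.mk g' : GaloisGroupUnramifiedOutside K S) :
        GaloisGroupUnramifiedOutside K S ⧸ N.map (toUnramifiedQuot K S)) =
          QuotientGroup.mk (QuotientGroup.mk g : GaloisGroupUnramifiedOutside K S) := fun h' =>
      hc (by rw [← cosetEquiv_mk_mk S N hNS g', ← cosetEquiv_mk_mk S N hNS g, h'])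
    rw [if_neg hc', if_neg hc, ZeroMemClass.coe_zero]

variable [N.FiniteIndex] [N'.FiniteIndex]

/-- `invariantsEquiv` intertwines `(π^*)^{N_S} = invariantsHom (coindFinRes)` with the pull-back of the
`G_S`-permutation modules. [cite: NeukirchSchmidtWingberg2008, I §5 Prop. (1.5.3)] -/
theorem invariantsEquiv_coindFinRes
    (w : Representation.invariants ((ρ.coindOpen N hN).toRepresentation.comp (ramificationSubgroup K S).subtype)) :
    invariantsEquiv S ρ N' hN' hN'S hρ
        ((ContinuousRep.invariantsHom (N := ramificationSubgroup K S) (ρ := ρ.coindOpen N hN) (ρ' := ρ.coindOpen N' hN')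
          (coindFinRes ρ.toTopRep h)).hom w) =
      (coindFinRes (ρ.quotientInvariants (ramificationSubgroup K S)).toTopRep (Subgroup.map_mono h)).hom
        (invariantsEquiv S ρ N hN hNS hρ w) :=
  mapsEquiv_coindFinRes S ρ N N' hN hN' h hNS hN'S hρ (w : absoluteGaloisGroup K ⧸ N → M)

/-- `invariantsEquiv` intertwines `Maps(F)^{N_S} = invariantsHom (coindFinMap F N)` with `Maps(F^{N_S})`.
[cite: NeukirchSchmidtWingberg2008, I §6 (induced modules)] -/
theorem invariantsEquiv_coindFinMap (F : ρ.toTopRep ⟶ ρ'.toTopRep)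
    (w : Representation.invariants ((ρ.coindOpen N hN).toRepresentation.comp (ramificationSubgroup K S).subtype)) :
    invariantsEquiv S ρ' N hN hNS hρ'
        ((ContinuousRep.invariantsHom (N := ramificationSubgroup K S) (ρ := ρ.coindOpen N hN) (ρ' := ρ'.coindOpen N hN)
          (coindFinMap F N)).hom w) =
      (coindFinMap (ContinuousRep.invariantsHom (N := ramificationSubgroup K S) F)
        (N.map (toUnramifiedQuot K S))).hom (invariantsEquiv S ρ N hN hNS hρ w) :=
  mapsEquiv_coindFinMap S ρ ρ' N hN hNS hρ hρ' F (w : absoluteGaloisGroup K ⧸ N → M)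

/-- `invariantsEquiv` intertwines `Σ^{N_S} = invariantsHom (coindFinSum)` with the fibre sum of the `G_S`-permutation
modules. [cite: NeukirchSchmidtWingberg2008, I §5 Prop. (1.5.3)] -/
theorem invariantsEquiv_coindFinSum [Fintype (absoluteGaloisGroup K ⧸ N')]
    [Fintype (GaloisGroupUnramifiedOutside K S ⧸ N'.map (toUnramifiedQuot K S))]
    (w : Representation.invariants ((ρ.coindOpen N' hN').toRepresentation.comp (ramificationSubgroup K S).subtype)) :
    invariantsEquiv S ρ N hN hNS hρ
        ((ContinuousRep.invariantsHom (N := ramificationSubgroup K S) (ρ := ρ.coindOpen N' hN') (ρ' := ρ.coindOpen N hN)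
          (coindFinSum ρ.toTopRep h)).hom w) =
      (coindFinSum (ρ.quotientInvariants (ramificationSubgroup K S)).toTopRep (Subgroup.map_mono h)).hom
        (invariantsEquiv S ρ N' hN' hN'S hρ w) :=
  mapsEquiv_coindFinSum S ρ N N' hN hN' h hNS hN'S hρ (w : absoluteGaloisGroup K ⧸ N' → M)

end Module

/-! ## §2 The transport `T = restrictedCohomologyEquiv` intertwines `Hⁿ(G_S, Σ)`, `Hⁿ(G_S, π^*)`, `Hⁿ(G_S, Maps(F))` -/

section Cohomology

variable [N.FiniteIndex] [N'.FiniteIndex]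

/-- **`T_{N′} ∘ Hⁿ(G_S, (π^*)^{N_S}) = Hⁿ(G_S, π̄^*) ∘ T_N`**, every degree (naturality of the continuous-cohomology transport).
[cite: NeukirchSchmidtWingberg2008, I §5 Prop. (1.5.3)] [cite: SerreGaloisCohomology1997, I §2.5] -/
theorem restrictedCohomologyEquiv_map_coindFinRes (n : ℕ) (c : restrictedCohomology (ρ.coindOpen N hN) S n) :
    restrictedCohomologyEquiv S ρ N' hN' hN'S hρ n
        ((ContinuousCohomology.map (ContinuousMonoidHom.id (GaloisGroupUnramifiedOutside K S))
          (ContinuousRep.invariantsHom (N := ramificationSubgroup K S) (ρ := ρ.coindOpen N hN)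
            (ρ' := ρ.coindOpen N' hN') (coindFinRes ρ.toTopRep h)) n).hom c) =
      cohomologyMap (coindFinRes (ρ.quotientInvariants (ramificationSubgroup K S)).toTopRep (Subgroup.map_mono h)) n
        (restrictedCohomologyEquiv S ρ N hN hNS hρ n c) := by
  unfold restrictedCohomologyEquiv
  exact continuousCohomologyAddEquiv_map
    (X := ((ρ.coindOpen N hN).quotientInvariants (ramificationSubgroup K S)).toTopRep)
    (X' := coindFin.{0, 0} (ρ.quotientInvariants (ramificationSubgroup K S)).toTopRep (N.map (toUnramifiedQuot K S)))
    (Y := ((ρ.coindOpen N' hN').quotientInvariants (ramificationSubgroup K S)).toTopRep)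
    (Y' := coindFin.{0, 0} (ρ.quotientInvariants (ramificationSubgroup K S)).toTopRep (N'.map (toUnramifiedQuot K S)))
    (invariantsEquiv S ρ N hN hNS hρ) (invariantsEquiv_map S ρ N hN hNS hρ)
    (invariantsEquiv S ρ N' hN' hN'S hρ) (invariantsEquiv_map S ρ N' hN' hN'S hρ)
    (ContinuousMonoidHom.id (GaloisGroupUnramifiedOutside K S))
    (ContinuousRep.invariantsHom (N := ramificationSubgroup K S) (ρ := ρ.coindOpen N hN)
      (ρ' := ρ.coindOpen N' hN') (coindFinRes ρ.toTopRep h))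
    (resIdHom (coindFinRes (ρ.quotientInvariants (ramificationSubgroup K S)).toTopRep (Subgroup.map_mono h)))
    (fun w => invariantsEquiv_coindFinRes S ρ N N' hN hN' h hNS hN'S hρ w) n c

/-- **`T′_N ∘ Hⁿ(G_S, Maps(F)^{N_S}) = Hⁿ(G_S, Maps(F^{N_S})) ∘ T_N`**, every degree. [cite: NeukirchSchmidtWingberg2008, I §6 (induced modules)]
[cite: SerreGaloisCohomology1997, I §2.5] -/
theorem restrictedCohomologyEquiv_map_coindFinMap (F : ρ.toTopRep ⟶ ρ'.toTopRep) (n : ℕ)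
    (c : restrictedCohomology (ρ.coindOpen N hN) S n) :
    restrictedCohomologyEquiv S ρ' N hN hNS hρ' n
        ((ContinuousCohomology.map (ContinuousMonoidHom.id (GaloisGroupUnramifiedOutside K S))
          (ContinuousRep.invariantsHom (N := ramificationSubgroup K S) (ρ := ρ.coindOpen N hN)
            (ρ' := ρ'.coindOpen N hN) (coindFinMap F N)) n).hom c) =
      cohomologyMap (coindFinMap (ContinuousRep.invariantsHom (N := ramificationSubgroup K S) F)
        (N.map (toUnramifiedQuot K S))) n (restrictedCohomologyEquiv S ρ N hN hNS hρ n c) := by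
  unfold restrictedCohomologyEquiv
  exact continuousCohomologyAddEquiv_map
    (X := ((ρ.coindOpen N hN).quotientInvariants (ramificationSubgroup K S)).toTopRep)
    (X' := coindFin.{0, 0} (ρ.quotientInvariants (ramificationSubgroup K S)).toTopRep (N.map (toUnramifiedQuot K S)))
    (Y := ((ρ'.coindOpen N hN).quotientInvariants (ramificationSubgroup K S)).toTopRep)
    (Y' := coindFin.{0, 0} (ρ'.quotientInvariants (ramificationSubgroup K S)).toTopRep (N.map (toUnramifiedQuot K S)))
    (invariantsEquiv S ρ N hN hNS hρ) (invariantsEquiv_map S ρ N hN hNS hρ)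
    (invariantsEquiv S ρ' N hN hNS hρ') (invariantsEquiv_map S ρ' N hN hNS hρ')
    (ContinuousMonoidHom.id (GaloisGroupUnramifiedOutside K S))
    (ContinuousRep.invariantsHom (N := ramificationSubgroup K S) (ρ := ρ.coindOpen N hN)
      (ρ' := ρ'.coindOpen N hN) (coindFinMap F N))
    (resIdHom (coindFinMap (ContinuousRep.invariantsHom (N := ramificationSubgroup K S) F)
      (N.map (toUnramifiedQuot K S))))
    (fun w => invariantsEquiv_coindFinMap S ρ ρ' N hN hNS hρ hρ' F w) n c

/-- **`T_N ∘ Hⁿ(G_S, Σ^{N_S}) = Hⁿ(G_S, Σ̄) ∘ T_{N′}`**, every degree. [cite: NeukirchSchmidtWingberg2008, I §5 Prop. (1.5.3)]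
[cite: SerreGaloisCohomology1997, I §2.5] -/
theorem restrictedCohomologyEquiv_map_coindFinSum [Fintype (absoluteGaloisGroup K ⧸ N')]
    [Fintype (GaloisGroupUnramifiedOutside K S ⧸ N'.map (toUnramifiedQuot K S))] (n : ℕ)
    (c : restrictedCohomology (ρ.coindOpen N' hN') S n) :
    restrictedCohomologyEquiv S ρ N hN hNS hρ n
        ((ContinuousCohomology.map (ContinuousMonoidHom.id (GaloisGroupUnramifiedOutside K S))
          (ContinuousRep.invariantsHom (N := ramificationSubgroup K S) (ρ := ρ.coindOpen N' hN')
            (ρ' := ρ.coindOpen N hN) (coindFinSum ρ.toTopRep h)) n).hom c) =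
      cohomologyMap (coindFinSum (ρ.quotientInvariants (ramificationSubgroup K S)).toTopRep (Subgroup.map_mono h)) n
        (restrictedCohomologyEquiv S ρ N' hN' hN'S hρ n c) := by
  unfold restrictedCohomologyEquiv
  exact continuousCohomologyAddEquiv_map
    (X := ((ρ.coindOpen N' hN').quotientInvariants (ramificationSubgroup K S)).toTopRep)
    (X' := coindFin.{0, 0} (ρ.quotientInvariants (ramificationSubgroup K S)).toTopRep (N'.map (toUnramifiedQuot K S)))
    (Y := ((ρ.coindOpen N hN).quotientInvariants (ramificationSubgroup K S)).toTopRep)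
    (Y' := coindFin.{0, 0} (ρ.quotientInvariants (ramificationSubgroup K S)).toTopRep (N.map (toUnramifiedQuot K S)))
    (invariantsEquiv S ρ N' hN' hN'S hρ) (invariantsEquiv_map S ρ N' hN' hN'S hρ)
    (invariantsEquiv S ρ N hN hNS hρ) (invariantsEquiv_map S ρ N hN hNS hρ)
    (ContinuousMonoidHom.id (GaloisGroupUnramifiedOutside K S))
    (ContinuousRep.invariantsHom (N := ramificationSubgroup K S) (ρ := ρ.coindOpen N' hN')
      (ρ' := ρ.coindOpen N hN) (coindFinSum ρ.toTopRep h))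
    (resIdHom (coindFinSum (ρ.quotientInvariants (ramificationSubgroup K S)).toTopRep (Subgroup.map_mono h)))
    (fun w => invariantsEquiv_coindFinSum S ρ N N' hN hN' h hNS hN'S hρ w) n c

end Cohomology

/-! ## §3 The dictionary: fibre sum ↦ relative corestriction, pull-back ↦ restriction, `Maps(F)` ↦ `Hⁿ(N̄, F^{N_S})` -/

section Dictionary

variable [N.FiniteIndex] [N'.FiniteIndex]

/-- **(S-res) `sh_S^{N′} (T_{N′} (Hⁿ(G_S, π^*) c)) = res_{N̄′ ≤ N̄} (sh_S^N (T_N c))`**, every degree: under the Ш-condition transport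
the pull-back `Ind_N M → Ind_{N′} M` (`φ ↦ φ ∘ (Γ_K ⧸ N′ → Γ_K ⧸ N)`) becomes the RESTRICTION `Hⁿ(N̄, M^{N_S}) → Hⁿ(N̄′, M^{N_S})`
of the layer groups (`resLe`, = `res_{L′/L}` for `N = Gal(K̄/L)`, `N′ = Gal(K̄/L′)`).
[cite: NeukirchSchmidtWingberg2008, I §5 Prop. (1.5.3), I §6 Prop. (1.6.4)–(1.6.5)] [cite: MilneADT2006, Ch. I §4 (p. 56)] -/
theorem layerShapiroEquiv_transport_coindFinRes (n : ℕ) (c : restrictedCohomology (ρ.coindOpen N hN) S n) :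
    layerShapiroEquiv S ρ N' hN' n (restrictedCohomologyEquiv S ρ N' hN' hN'S hρ n
        ((ContinuousCohomology.map (ContinuousMonoidHom.id (GaloisGroupUnramifiedOutside K S))
          (ContinuousRep.invariantsHom (N := ramificationSubgroup K S) (ρ := ρ.coindOpen N hN)
            (ρ' := ρ.coindOpen N' hN') (coindFinRes ρ.toTopRep h)) n).hom c)) =
      resLe (ρ.quotientInvariants (ramificationSubgroup K S)).toTopRep (Subgroup.map_mono h) n
        (layerShapiroEquiv S ρ N hN n (restrictedCohomologyEquiv S ρ N hN hNS hρ n c)) := by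
  rw [restrictedCohomologyEquiv_map_coindFinRes]
  haveI : TotallyDisconnectedSpace (GaloisGroupUnramifiedOutside K S) :=
    Literature.GroupTheory.ProfiniteSubquotients.totallyDisconnectedSpace_quotient
      (ramificationSubgroup K S) (ramificationSubgroup_isClosed K S)
  exact ContinuousRep.shapiroCoindFinAddEquiv_cohomologyMap_coindFinRes (ρ.quotientInvariants (ramificationSubgroup K S))
    (Subgroup.map_mono h) (isOpen_map_toUnramifiedQuot S N hN) (isOpen_map_toUnramifiedQuot S N' hN') n _

/-- **(S-coeff) `sh_S'^N (T′_N (Hⁿ(G_S, Maps(F)) c)) = Hⁿ(N̄, F^{N_S}|_{N̄}) (sh_S^N (T_N c))`**, every degree: under the transport a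
coefficient change `F : M → M′` of `Ind` becomes `Hⁿ(N̄, ·)` of `F^{N_S}` restricted to the layer group (`cohomologyMap
(subgroupRepMap F^{N_S} N̄)`; e.g. `ζ ↦ ζ^p` on `μ_{p^{k+1}} → μ_{p^k}`, cell `bsd-print-cf2`'s `levelRed`).
[cite: NeukirchSchmidtWingberg2008, I §6 Prop. (1.6.4)–(1.6.5)] [cite: MilneADT2006, Ch. I §4 (p. 56)] -/
theorem layerShapiroEquiv_transport_coindFinMap (F : ρ.toTopRep ⟶ ρ'.toTopRep) (n : ℕ)
    (c : restrictedCohomology (ρ.coindOpen N hN) S n) :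
    layerShapiroEquiv S ρ' N hN n (restrictedCohomologyEquiv S ρ' N hN hNS hρ' n
        ((ContinuousCohomology.map (ContinuousMonoidHom.id (GaloisGroupUnramifiedOutside K S))
          (ContinuousRep.invariantsHom (N := ramificationSubgroup K S) (ρ := ρ.coindOpen N hN)
            (ρ' := ρ'.coindOpen N hN) (coindFinMap F N)) n).hom c)) =
      cohomologyMap (subgroupRepMap (ContinuousRep.invariantsHom (N := ramificationSubgroup K S) F)
        (N.map (toUnramifiedQuot K S))) n
        (layerShapiroEquiv S ρ N hN n (restrictedCohomologyEquiv S ρ N hN hNS hρ n c)) := by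
  rw [restrictedCohomologyEquiv_map_coindFinMap]
  haveI : TotallyDisconnectedSpace (GaloisGroupUnramifiedOutside K S) :=
    Literature.GroupTheory.ProfiniteSubquotients.totallyDisconnectedSpace_quotient
      (ramificationSubgroup K S) (ramificationSubgroup_isClosed K S)
  exact ContinuousRep.shapiroCoindFinAddEquiv_cohomologyMap_coindFinMap (ρ.quotientInvariants (ramificationSubgroup K S))
    (ρ'.quotientInvariants (ramificationSubgroup K S)) (N.map (toUnramifiedQuot K S)) (isOpen_map_toUnramifiedQuot S N hN)
    (ContinuousRep.invariantsHom (N := ramificationSubgroup K S) F) n _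

/-- **(S-cor) `sh_S^N (T_N (Hⁿ(G_S, Σ) c)) = relCor N̄ N̄′ (sh_S^{N′} (T_{N′} c))`**, every degree: under the Ш-condition transport the
trace `Ind_{N′} M → Ind_N M` (fibre sum along `Γ_K ⧸ N′ → Γ_K ⧸ N`) becomes the relative CORESTRICTION
`cor_{L′/L} : Hⁿ(N̄′, M^{N_S}) → Hⁿ(N̄, M^{N_S})` of the layer groups — the tree's all-degree `relCor = cor ∘ toSubgroupOf`
(`RelativeCorestrictionConj`; cell `bsd-print-cf2`'s `JohnsonLeungKings2011.relCores` unfolds to the same composite), for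
ARBITRARY `Fintype` instances on `Γ_K ⧸ N′`, `G_S ⧸ N̄′`, `N̄ ⧸ N̄′`. [cite: SerreGaloisCohomology1997, I §2.5 (corestriction)]
[cite: NeukirchSchmidtWingberg2008, I §5 Prop. (1.5.3)–(1.5.4), I §6 Prop. (1.6.4)–(1.6.5)] [cite: MilneADT2006, Ch. I §4 (p. 56)] -/
theorem layerShapiroEquiv_transport_coindFinSum [Fintype (absoluteGaloisGroup K ⧸ N')]
    [Fintype (GaloisGroupUnramifiedOutside K S ⧸ N'.map (toUnramifiedQuot K S))]
    [Fintype (↥(N.map (toUnramifiedQuot K S)) ⧸ (N'.map (toUnramifiedQuot K S)).subgroupOf (N.map (toUnramifiedQuot K S)))]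
    (n : ℕ) (c : restrictedCohomology (ρ.coindOpen N' hN') S n) :
    haveI : TotallyDisconnectedSpace (GaloisGroupUnramifiedOutside K S) :=
      Literature.GroupTheory.ProfiniteSubquotients.totallyDisconnectedSpace_quotient
        (ramificationSubgroup K S) (ramificationSubgroup_isClosed K S)
    haveI : IsClosed ((N.map (toUnramifiedQuot K S) : Subgroup (GaloisGroupUnramifiedOutside K S)) :
        Set (GaloisGroupUnramifiedOutside K S)) := Subgroup.isClosed_of_isOpen _ (isOpen_map_toUnramifiedQuot S N hN)
    haveI : IsClosed ((N'.map (toUnramifiedQuot K S) : Subgroup (GaloisGroupUnramifiedOutside K S)) :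
        Set (GaloisGroupUnramifiedOutside K S)) := Subgroup.isClosed_of_isOpen _ (isOpen_map_toUnramifiedQuot S N' hN')
    layerShapiroEquiv S ρ N hN n (restrictedCohomologyEquiv S ρ N hN hNS hρ n
        ((ContinuousCohomology.map (ContinuousMonoidHom.id (GaloisGroupUnramifiedOutside K S))
          (ContinuousRep.invariantsHom (N := ramificationSubgroup K S) (ρ := ρ.coindOpen N' hN')
            (ρ' := ρ.coindOpen N hN) (coindFinSum ρ.toTopRep h)) n).hom c)) =
      relCor (N.map (toUnramifiedQuot K S)) (N'.map (toUnramifiedQuot K S))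
        (ρ.quotientInvariants (ramificationSubgroup K S)) (Subgroup.map_mono h) n
        (layerShapiroEquiv S ρ N' hN' n (restrictedCohomologyEquiv S ρ N' hN' hN'S hρ n c)) := by
  haveI : TotallyDisconnectedSpace (GaloisGroupUnramifiedOutside K S) :=
    Literature.GroupTheory.ProfiniteSubquotients.totallyDisconnectedSpace_quotient
      (ramificationSubgroup K S) (ramificationSubgroup_isClosed K S)
  haveI : IsClosed ((N.map (toUnramifiedQuot K S) : Subgroup (GaloisGroupUnramifiedOutside K S)) :
      Set (GaloisGroupUnramifiedOutside K S)) := Subgroup.isClosed_of_isOpen _ (isOpen_map_toUnramifiedQuot S N hN)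
  haveI : IsClosed ((N'.map (toUnramifiedQuot K S) : Subgroup (GaloisGroupUnramifiedOutside K S)) :
      Set (GaloisGroupUnramifiedOutside K S)) := Subgroup.isClosed_of_isOpen _ (isOpen_map_toUnramifiedQuot S N' hN')
  rw [restrictedCohomologyEquiv_map_coindFinSum]
  exact ContinuousRep.shapiroCoindFinAddEquiv_cohomologyMap_coindFinSum (ρ.quotientInvariants (ramificationSubgroup K S))
    (Subgroup.map_mono h) (isOpen_map_toUnramifiedQuot S N hN) (isOpen_map_toUnramifiedQuot S N' hN') n _

end Dictionary

end ShaLayer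

end Literature.NumberTheory.GaloisCohomology

end
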